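import Summits.BirchSwinnertonDyer.BirchSwinnertonDyer.Theorems.ByReductionTypeAtTwoGoodOrdTowerCoinvCocycle
import HarnessLib

/-!
# Route `ByReductionTypeAtTwo`, item `OrdKatoHalfAtTwo` (stmt-BirchSwinnertonDyer-19271), TOWER road, the
# GOOD-ORDINARY local constant at `v ∣ 2`: KERNEL BRICK G3 — Kummer on `E₁`: coinvariant `p`-torsion classes of the fixed
# module versus continuous characters of the local layer group `H_n`, at ANY prime `p`

HONEST FRAMING (cell `bsd-2adic`, run/shared/lean/pub/bsd-2adic/, seat `bsd-2adic-tower-1` GEN 11, HUMAN RULINGS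
D-0036 / D-0054 / D-0074): TOOL theorem only (no definition, no named fact, no `sorry`); closes nothing by itself;
nothing booked; BSD is not proved by any of this. Third brick of the KERNELISATION of the consumed projection
`#𝒦_{v,n}[2^∞][2] ≤ 4` of the PRINT binder `hS34 = Greenberg1999.lemma34_localTowerKerPrimary_cyclicExtension_rat`
(Greenberg, LNM 1716, §3 Lemma 3.4 / Prop. 2.5), scope memo HOME/tower/SCOPE-hS34-layer-kernel-at-2-GEN7.md §1 steps 2–3.
Setting of BRICK G2 (`…GoodOrdTowerCoinvCocycle.lean`): `p` any prime, `κ` cyclotomic, `v ∋ p`, `K = ℚ_v`, `Γ = Gal(K̄/K)`,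
`H_n`, `H_∞`, `E(K̄_v) = localPoints W K`, `g ∈ H_n` a topological generator modulo `H_∞`, `A₁ ≤ E(K̄_v)` a `Γ`-stable
`p`-DIVISIBLE subgroup (the formal group `E₁(K̄_v)` of good reduction, hypothesis (div₁) of the tree's layer-`0` proof of
Lemma 3.4) whose `p`-torsion `A₁[p] = ιZ(Z)` is fixed pointwise by `Γ` (automatic at `p = 2`: `#Ê[2] = 2`).

* **`natCard_torsionBy_coinv_mul_card_quotient_le_card_contHom`** — with `M₁ = A₁ ∩ E(K̄_v)^{H_∞}`, `D₁ = g − 1` on `M₁`,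
  `Aₙ = A₁ ∩ E(K̄_v)^{H_n}`: if the continuous homomorphisms `H_n → Z` are finite in number then
  `#(M₁/D₁M₁)[p] · #(Aₙ/pAₙ) ≤ #Hom_cont(H_n, Z)` (with finiteness of both factors). Proof with explicit cocycles: a
  `p`-torsion class `[x]`, `p x = D₁ y`, gives `χ = c − ∂ỹ` (`c` = BRICK G2's inflated cocycle, `p ỹ = y`), a continuous
  crossed homomorphism with values in the `Γ`-fixed `A₁[p]`, i.e. a continuous homomorphism `H_n → Z`; `b ∈ Aₙ` gives the
  Kummer character `κ(b) = ∂b̃`, `p b̃ = b`, with `ker κ = pAₙ`; and `[x] ↦ χ mod κ(Aₙ)` is injective (`χ − χ' = κ(b)` ⇒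
  `a = ỹ' − ỹ − b̃ ∈ M₁` on `H_∞` and `x − x' = (g−1)(−a)` at `g`). This is the Kummer sequence
  `Aₙ/p ↪ H¹(H_n, A₁[p]) ↠ H¹(H_n, A₁)[p]` composed with the inflation `(M₁/D₁M₁)[p] ↪ H¹(H_n, A₁)[p]`.

With BRICK G1 (`…CoinvDevissage`, the reduction-map dévissage) and BRICK 11 this reduces hS34's projection at `p = 2` to:
Hensel lifts `Ẽ(𝔽₂) → E(ℚ₂)`, `#Ẽ[2] ≤ 2`, the count `#Hom_cont(H_n, ℤ/2) = 2^{2^n+2}` (local Euler–Poincaré + `#H²(H_n, μ₂) = 2`)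
and Lutz at the layer `#(E₁(L_n)/2) = 2^{2^n} · 2` (`L_n = K̄_v^{H_n}`) — the remaining bricks.

References: R. Greenberg, LNM 1716 (1999), §3 Lemma 3.4 (p. 89) with Prop. 2.5 (p. 80); J.-P. Serre, *Local Fields*,
XIII §1; J. Silverman, *AEC* VIII §2 (Kummer pairing); scope memo §1.
-/

set_option autoImplicit false
-- the Theorems namespace of this sub repeats the summit name by design (D-0017 nested layout: Summit.<S>.<Sub>)
set_option linter.dupNamespace false

noncomputable section

open scoped Classical

universe u

namespace Summit.BirchSwinnertonDyer.BirchSwinnertonDyer.Theorems.GoodOrdTower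

open NumberField IsDedekindDomain Field PadicInt Literature.NumberTheory.EllipticCurves
  Literature.NumberTheory.GaloisRepresentations WeierstrassCurve

variable {p : ℕ} [Fact p.Prime] {κ : ZpExtension ℚ p}

/-! ### The Kummer count: `#(A₁^{H_∞}/(g−1))[p] · #(A₁^{H_n}/p) ≤ #Hom_cont(H_n, A₁[p])` -/

/-- **Coinvariant `p`-torsion classes of the fixed module versus characters of `H_n` (Kummer on `E₁`).** Setting of
`exists_contOneCocycles_inflate`; moreover `A₁` is `p`-DIVISIBLE (hypothesis (div₁) of Greenberg's Lemma 3.4: the formal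
group of good reduction over `K̄_v`) and its `p`-torsion `A₁[p]` is the image of an injective `ιZ : Z → E(K̄_v)` fixed
pointwise by `Γ`. Let `M₁ = A₁ ∩ E(K̄_v)^{H_∞}` with `D₁ = g − 1` on it, and `Aₙ = A₁ ∩ E(K̄_v)^{H_n}`. If the continuous
homomorphisms `H_n → Z` are finite in number, then the `p`-torsion of `M₁/D₁M₁` and the quotient `Aₙ/pAₙ` are finite and
`#(M₁/D₁ M₁)[p] · #(Aₙ/p Aₙ) ≤ #Hom_cont(H_n, Z)`.
Proof: to a class `[x]` with `p x = D₁ y` attach `χ = c − ∂ỹ` (`c` the inflated cocycle of `exists_contOneCocycles_inflate`,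
`p ỹ = y`): a continuous cocycle with values in the `Γ`-fixed `A₁[p] = ιZ(Z)`, i.e. a continuous homomorphism
`H_n → Z`; to `b ∈ Aₙ` attach the Kummer character `κ(b) = ∂b̃` (`p b̃ = b`), with `ker κ = pAₙ`; and
`[x] ↦ χ mod κ(Aₙ)` is injective: `χ − χ' = κ(b)` forces `a = ỹ' − ỹ − b̃ ∈ M₁` (evaluate on `H_∞`) and
`x − x' = −(g a − a)` (evaluate at `g`). This is the Kummer sequence `A₁^{H_n}/p ↪ H¹(H_n, A₁[p]) ↠ H¹(H_n, A₁)[p]`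
combined with the inflation `(A₁^{H_∞}/(g−1))[p] ↪ H¹(H_n, A₁)[p]`, written with explicit cocycles.
[cite: GreenbergLNM1716, §3 Lemma 3.4 (p. 89) with Prop. 2.5 (p. 80)] [cite: SerreLocalFields1979, XIII §1 Prop. 1] -/
theorem natCard_torsionBy_coinv_mul_card_quotient_le_card_contHom (hκ : κ.IsCyclotomic)
    (v : HeightOneSpectrum (𝓞 ℚ)) (hv : ((p : ℕ) : 𝓞 ℚ) ∈ v.asIdeal) (W : WeierstrassCurve ℚ) (n : ℕ)
    {g : absoluteGaloisGroup (v.adicCompletion ℚ)}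
    (hg : g ∈ localSubgroup (κ.layerSubgroup n) (v.adicCompletion ℚ))
    (hgen : ∀ U : Subgroup (absoluteGaloisGroup (v.adicCompletion ℚ)),
      IsOpen (U : Set (absoluteGaloisGroup (v.adicCompletion ℚ))) →
        localSubgroup κ.kerSubgroup (v.adicCompletion ℚ) ≤ U → g ∈ U →
          localSubgroup (κ.layerSubgroup n) (v.adicCompletion ℚ) ≤ U)
    (A₁ : AddSubgroup (localPoints W (v.adicCompletion ℚ)))
    (hstab : ∀ (σ : absoluteGaloisGroup (v.adicCompletion ℚ)) (a : localPoints W (v.adicCompletion ℚ)),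
      a ∈ A₁ → σ • a ∈ A₁)
    (hdiv₁ : ∀ a ∈ A₁, ∃ b ∈ A₁, p • b = a)
    {Z : Type} [AddCommGroup Z] [TopologicalSpace Z] [DiscreteTopology Z]
    (ιZ : Z →+ localPoints W (v.adicCompletion ℚ)) (hιZ : Function.Injective ιZ)
    (hZr : ∀ a : localPoints W (v.adicCompletion ℚ), a ∈ A₁ ∧ p • a = 0 ↔ a ∈ ιZ.range)
    (hZfix : ∀ (σ : absoluteGaloisGroup (v.adicCompletion ℚ)) (z : Z), σ • ιZ z = ιZ z)
    (M₁ : AddSubgroup (localPoints W (v.adicCompletion ℚ)))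
    (hM₁ : ∀ a, a ∈ M₁ ↔ a ∈ A₁ ∧ ∀ h ∈ localSubgroup κ.kerSubgroup (v.adicCompletion ℚ), h • a = a)
    (D₁ : M₁ →+ M₁) (hD₁ : ∀ a : M₁, ((D₁ a : M₁) : localPoints W (v.adicCompletion ℚ)) = g • (a : _) - a)
    (Aₙ : AddSubgroup (localPoints W (v.adicCompletion ℚ)))
    (hAₙ : ∀ a, a ∈ Aₙ ↔ a ∈ A₁ ∧ ∀ σ ∈ localSubgroup (κ.layerSubgroup n) (v.adicCompletion ℚ), σ • a = a)
    [Finite {f : localSubgroup (κ.layerSubgroup n) (v.adicCompletion ℚ) → Z //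
      Continuous f ∧ ∀ a b, f (a * b) = f a + f b}] :
    Finite {c : M₁ ⧸ D₁.range // p • c = 0} ∧
      Finite (Aₙ ⧸ (nsmulAddMonoidHom p : Aₙ →+ Aₙ).range) ∧
      Nat.card {c : M₁ ⧸ D₁.range // p • c = 0} * Nat.card (Aₙ ⧸ (nsmulAddMonoidHom p : Aₙ →+ Aₙ).range) ≤
        Nat.card {f : localSubgroup (κ.layerSubgroup n) (v.adicCompletion ℚ) → Z //
          Continuous f ∧ ∀ a b, f (a * b) = f a + f b} := by
  -- notation
  let K := v.adicCompletion ℚ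
  let P : Type := localPoints W K
  let Hn : Subgroup (absoluteGaloisGroup K) := localSubgroup (κ.layerSubgroup n) K
  let γ : Hn := ⟨g, hg⟩
  -- a left inverse of `ιZ`; `A₁[p] = ιZ(Z)` is fixed by `Γ`
  obtain ⟨linv, hlinv⟩ := hιZ.hasLeftInverse
  have hιlinv : ∀ a : P, a ∈ A₁ → p • a = 0 → ιZ (linv a) = a := fun a ha hpa ↦ by
    obtain ⟨z, rfl⟩ := (hZr a).mp ⟨ha, hpa⟩
    rw [hlinv z]
  have hfixZ : ∀ a : P, a ∈ A₁ → p • a = 0 → ∀ σ : absoluteGaloisGroup K, σ • a = a := fun a ha hpa σ ↦ by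
    obtain ⟨z, rfl⟩ := (hZr a).mp ⟨ha, hpa⟩
    exact hZfix σ z
  -- continuous homomorphisms `H_n → Z`, as an additive subgroup of `H_n → Z`
  let HomZ : AddSubgroup (Hn → Z) :=
    { carrier := {f | Continuous f ∧ ∀ a b, f (a * b) = f a + f b}
      zero_mem' := ⟨continuous_const, fun a b ↦ by simp⟩
      add_mem' := fun {f f'} hf hf' ↦ ⟨hf.1.add hf'.1, fun a b ↦ by
        simp only [Pi.add_apply, hf.2 a b, hf'.2 a b]; abel⟩
      neg_mem' := fun {f} hf ↦ ⟨hf.1.neg, fun a b ↦ by simp only [Pi.neg_apply, hf.2 a b]; abel⟩ }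
  have hmemHomZ : ∀ f : Hn → Z, f ∈ HomZ ↔ Continuous f ∧ ∀ a b, f (a * b) = f a + f b := fun _ ↦ Iff.rfl
  haveI hHomZfin : Finite HomZ := Finite.of_equiv _ (Equiv.subtypeEquivRight fun f ↦ (hmemHomZ f).symm)
  have hcardHomZ : Nat.card {f : Hn → Z // Continuous f ∧ ∀ a b, f (a * b) = f a + f b} = Nat.card HomZ :=
    Nat.card_congr (Equiv.subtypeEquivRight fun f ↦ (hmemHomZ f).symm)
  -- a continuous `A₁[p]`-valued crossed homomorphism of `H_n` gives a continuous homomorphism `H_n → Z`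
  have hmkHom : ∀ w : Hn → P, Continuous w → (∀ σ, w σ ∈ A₁ ∧ p • w σ = 0) →
      (∀ σ τ, w (σ * τ) = w σ + (σ : absoluteGaloisGroup K) • w τ) → linv ∘ w ∈ HomZ := by
    intro w hw hwZ hcoc
    refine ⟨(((IsLocallyConstant.iff_continuous w).mpr hw).comp linv).continuous, fun σ τ ↦ hιZ ?_⟩
    rw [map_add, Function.comp_apply, Function.comp_apply, Function.comp_apply,
      hιlinv _ (hwZ _).1 (hwZ _).2, hιlinv _ (hwZ _).1 (hwZ _).2, hιlinv _ (hwZ _).1 (hwZ _).2, hcoc,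
      hfixZ _ (hwZ τ).1 (hwZ τ).2]
  -- coboundaries `σ ↦ σ t - t` of elements `t ∈ A₁` with `p t` fixed by `H_n`
  have hcob : ∀ t : P, t ∈ A₁ → (∀ σ : Hn, (σ : absoluteGaloisGroup K) • (p • t) = p • t) →
      (Continuous fun σ : Hn ↦ (σ : absoluteGaloisGroup K) • t - t) ∧
      (∀ σ : Hn, (σ : absoluteGaloisGroup K) • t - t ∈ A₁ ∧ p • ((σ : absoluteGaloisGroup K) • t - t) = 0) ∧
      (∀ σ τ : Hn, ((σ * τ : Hn) : absoluteGaloisGroup K) • t - t =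
        ((σ : absoluteGaloisGroup K) • t - t) + (σ : absoluteGaloisGroup K) • ((τ : absoluteGaloisGroup K) • t - t)) := by
    intro t ht hpt
    refine ⟨((continuous_smul_localPoints W K t).comp continuous_subtype_val).sub continuous_const,
      fun σ ↦ ⟨A₁.sub_mem (hstab _ _ ht) ht, ?_⟩, fun σ τ ↦ ?_⟩
    · rw [smul_sub, smul_comm, hpt σ, sub_self]
    · rw [Subgroup.coe_mul, mul_smul, smul_sub]; abel
  -- roots: `rt a ∈ A₁`, `p • rt a = a` for `a ∈ A₁`
  choose rt hrtA hrt using hdiv₁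
  -- the root of `b ∈ Aₙ`
  have hAₙA : ∀ b : Aₙ, (b : P) ∈ A₁ := fun b ↦ ((hAₙ b).mp b.2).1
  have hrtfix : ∀ (b : Aₙ) (σ : Hn), (σ : absoluteGaloisGroup K) • (p • rt b (hAₙA b)) = p • rt b (hAₙA b) :=
    fun b σ ↦ by rw [hrt b (hAₙA b)]; exact ((hAₙ b).mp b.2).2 _ σ.2
  -- the Kummer map `kum : Aₙ →+ HomZ`, `b ↦ (σ ↦ σ b̃ - b̃)`
  have hkmem : ∀ b : Aₙ, (linv ∘ fun σ : Hn ↦ (σ : absoluteGaloisGroup K) • rt b (hAₙA b) - rt b (hAₙA b)) ∈ HomZ :=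
    fun b ↦ by
      obtain ⟨hc, hZ', hcoc⟩ := hcob _ (hrtA b (hAₙA b)) (hrtfix b)
      exact hmkHom _ hc hZ' hcoc
  -- independence of the root: `σ t - t` only depends on `p t` (two roots differ by a `Γ`-fixed element of `A₁[p]`)
  have hindep : ∀ (t t' : P), t ∈ A₁ → t' ∈ A₁ → p • t = p • t' →
      ∀ σ : absoluteGaloisGroup K, σ • t - t = σ • t' - t' := by
    intro t t' ht ht' hp σ
    have hd : σ • (t - t') = t - t' :=
      hfixZ _ (A₁.sub_mem ht ht') (by rw [smul_sub, hp, sub_self]) σ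
    rw [smul_sub] at hd
    exact sub_eq_sub_iff_sub_eq_sub.mp hd
  let kum : Aₙ →+ HomZ :=
    { toFun := fun b ↦ ⟨_, hkmem b⟩
      map_zero' := by
        refine Subtype.ext (funext fun σ ↦ hιZ ?_)
        change ιZ (linv ((σ : absoluteGaloisGroup K) • rt (0 : Aₙ) (hAₙA 0) - rt (0 : Aₙ) (hAₙA 0))) =
          ιZ (((0 : HomZ) : Hn → Z) σ)
        rw [hιlinv _ (A₁.sub_mem (hstab _ _ (hrtA _ _)) (hrtA _ _))
          (by rw [smul_sub, smul_comm, hrtfix 0 σ, sub_self]),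
          hindep _ 0 (hrtA _ _) A₁.zero_mem (by rw [hrt, smul_zero]; rfl) σ, smul_zero, sub_zero]
        exact (map_zero ιZ).symm
      map_add' := fun b b' ↦ by
        refine Subtype.ext (funext fun σ ↦ hιZ ?_)
        change ιZ (linv ((σ : absoluteGaloisGroup K) • rt _ (hAₙA (b + b')) - rt _ (hAₙA (b + b')))) =
          ιZ (((linv ∘ fun σ : Hn ↦ (σ : absoluteGaloisGroup K) • rt b (hAₙA b) - rt b (hAₙA b)) σ) +
            ((linv ∘ fun σ : Hn ↦ (σ : absoluteGaloisGroup K) • rt b' (hAₙA b') - rt b' (hAₙA b')) σ))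
        rw [map_add, Function.comp_apply, Function.comp_apply,
          hιlinv _ (A₁.sub_mem (hstab _ _ (hrtA _ _)) (hrtA _ _))
            (by rw [smul_sub, smul_comm, hrtfix _ σ, sub_self]),
          hιlinv _ (A₁.sub_mem (hstab _ _ (hrtA _ _)) (hrtA _ _))
            (by rw [smul_sub, smul_comm, hrtfix _ σ, sub_self]),
          hιlinv _ (A₁.sub_mem (hstab _ _ (hrtA _ _)) (hrtA _ _))
            (by rw [smul_sub, smul_comm, hrtfix _ σ, sub_self]),
          hindep (rt _ (hAₙA (b + b'))) (rt b (hAₙA b) + rt b' (hAₙA b')) (hrtA _ _)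
            (A₁.add_mem (hrtA _ _) (hrtA _ _)) (by rw [hrt, smul_add, hrt, hrt]; rfl) σ,
          smul_add]
        abel }
  have hkum_apply : ∀ (b : Aₙ) (σ : Hn),
      ιZ (((kum b : HomZ) : Hn → Z) σ) = (σ : absoluteGaloisGroup K) • rt b (hAₙA b) - rt b (hAₙA b) := fun b σ ↦
    hιlinv _ (A₁.sub_mem (hstab _ _ (hrtA _ _)) (hrtA _ _)) (by rw [smul_sub, smul_comm, hrtfix _ σ, sub_self])
  -- `ker kum = p Aₙ`
  have hker : kum.ker = (nsmulAddMonoidHom p : Aₙ →+ Aₙ).range := by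
    ext b
    rw [AddMonoidHom.mem_ker, AddMonoidHom.mem_range]
    constructor
    · intro hb
      -- `σ b̃ = b̃` for all `σ ∈ H_n`, so `b̃ ∈ Aₙ` and `b = p b̃`
      have hfix : ∀ σ : Hn, (σ : absoluteGaloisGroup K) • rt b (hAₙA b) = rt b (hAₙA b) := fun σ ↦ by
        have h := hkum_apply b σ
        rw [hb] at h
        change ιZ (((0 : HomZ) : Hn → Z) σ) = _ at h
        rw [show ((0 : HomZ) : Hn → Z) σ = 0 from rfl, map_zero] at h
        exact (sub_eq_zero.mp h.symm)
      refine ⟨⟨rt b (hAₙA b), (hAₙ _).mpr ⟨hrtA _ _, fun σ hσ ↦ hfix ⟨σ, hσ⟩⟩⟩, Subtype.ext ?_⟩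
      change p • rt b (hAₙA b) = b
      exact hrt b (hAₙA b)
    · rintro ⟨a, rfl⟩
      refine Subtype.ext (funext fun σ ↦ hιZ ?_)
      rw [hkum_apply]
      change (σ : absoluteGaloisGroup K) • rt _ (hAₙA (p • a)) - rt _ (hAₙA (p • a)) = ιZ (((0 : HomZ) : Hn → Z) σ)
      rw [show ((0 : HomZ) : Hn → Z) σ = 0 from rfl, map_zero,
        hindep _ (a : P) (hrtA _ _) (hAₙA a) (by rw [hrt]; rfl) σ, ((hAₙ a).mp a.2).2 _ σ.2, sub_self]
  -- `#(Aₙ/pAₙ) = #range kum`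
  have hcardK : Nat.card (Aₙ ⧸ (nsmulAddMonoidHom p : Aₙ →+ Aₙ).range) = Nat.card kum.range := by
    rw [← hker]
    exact Nat.card_congr (QuotientAddGroup.quotientKerEquivRange kum).toEquiv
  haveI hKfin : Finite kum.range := inferInstance
  -- the map `Φ : (M₁/D₁M₁)[p] → HomZ ⧸ range kum`
  have hM₁A : ∀ x : M₁, (x : P) ∈ A₁ := fun x ↦ ((hM₁ x).mp x.2).1
  have hM₁i : ∀ x : M₁, ∀ h ∈ localSubgroup κ.kerSubgroup K, h • (x : P) = x := fun x ↦ ((hM₁ x).mp x.2).2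
  -- representatives and the relation `p x = g y - y`
  have hrep : ∀ c : {c : M₁ ⧸ D₁.range // p • c = 0}, ∃ x y : M₁,
      (QuotientAddGroup.mk x : M₁ ⧸ D₁.range) = c.1 ∧ p • (x : P) = g • (y : P) - y := by
    intro c
    obtain ⟨x, hx⟩ := QuotientAddGroup.mk_surjective c.1
    have hpx : (QuotientAddGroup.mk (p • x) : M₁ ⧸ D₁.range) = 0 := by rw [QuotientAddGroup.mk_nsmul, hx]; exact c.2
    rw [QuotientAddGroup.eq_zero_iff] at hpx
    obtain ⟨y, hy⟩ := hpx
    refine ⟨x, y, hx, ?_⟩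
    rw [← hD₁ y, hy, AddSubgroup.coe_nsmul]
  choose xr yr hxr hrel using hrep
  -- the inflated cocycles
  have hcoc : ∀ c : {c : M₁ ⧸ D₁.range // p • c = 0}, ∃ cc : contOneCocycles (discreteTopRep Hn P),
      (∀ σ : Hn, (σ : absoluteGaloisGroup K) ∈ localSubgroup κ.kerSubgroup K → cc.1 σ = 0) ∧
      cc.1 γ = (xr c : P) ∧ (∀ σ : Hn, cc.1 σ ∈ A₁) ∧
      (∀ σ : Hn, p • cc.1 σ = (σ : absoluteGaloisGroup K) • (yr c : P) - yr c) := fun c ↦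
    exists_contOneCocycles_inflate hκ v hv W n hg hgen A₁ hstab (fun a ha hpa σ ↦ hfixZ a ha hpa σ)
      (hM₁A (xr c)) (hM₁i (xr c)) (hM₁i (yr c)) (hrel c)
  choose cc hcc0 hccγ hccA hccp using hcoc
  -- `χ_c = cc - ∂ỹ` with `ỹ = rt y`: a continuous `A₁[p]`-valued crossed homomorphism of `H_n`
  have hchi : ∀ c : {c : M₁ ⧸ D₁.range // p • c = 0},
      (linv ∘ fun σ : Hn ↦ (cc c).1 σ -
        ((σ : absoluteGaloisGroup K) • rt (yr c : P) (hM₁A (yr c)) - rt (yr c : P) (hM₁A (yr c)))) ∈ HomZ := by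
    intro c
    refine hmkHom _ (((cc c).1.continuous).sub
      (((continuous_smul_localPoints W K _).comp continuous_subtype_val).sub continuous_const))
      (fun σ ↦ ⟨A₁.sub_mem (hccA c σ) (A₁.sub_mem (hstab _ _ (hrtA _ _)) (hrtA _ _)), ?_⟩) (fun σ τ ↦ ?_)
    · rw [smul_sub, hccp c σ, smul_sub, smul_comm, hrt, sub_self]
    · have h1 := (cc c).2 σ τ
      change (cc c).1 (σ * τ) = (cc c).1 σ + (σ : absoluteGaloisGroup K) • (cc c).1 τ at h1
      rw [h1, Subgroup.coe_mul, mul_smul, smul_sub, smul_sub]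
      abel
  let chi : {c : M₁ ⧸ D₁.range // p • c = 0} → HomZ := fun c ↦ ⟨_, hchi c⟩
  have hchi_apply : ∀ (c : {c : M₁ ⧸ D₁.range // p • c = 0}) (σ : Hn),
      ιZ (((chi c : HomZ) : Hn → Z) σ) = (cc c).1 σ -
        ((σ : absoluteGaloisGroup K) • rt (yr c : P) (hM₁A (yr c)) - rt (yr c : P) (hM₁A (yr c))) := fun c σ ↦
    hιlinv _ (A₁.sub_mem (hccA c σ) (A₁.sub_mem (hstab _ _ (hrtA _ _)) (hrtA _ _)))
      (by rw [smul_sub, hccp c σ, smul_sub, smul_comm, hrt, sub_self])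
  -- `Φ c = χ_c mod range kum` is injective
  let Φ : {c : M₁ ⧸ D₁.range // p • c = 0} → HomZ ⧸ kum.range := fun c ↦ QuotientAddGroup.mk (chi c)
  have hΦ : Function.Injective Φ := by
    intro c c' hcc'
    have hmem : chi c - chi c' ∈ kum.range := by
      rw [← QuotientAddGroup.eq_iff_sub_mem]
      exact hcc'
    obtain ⟨b, hb⟩ := hmem
    -- the values: `χ_c σ - χ_{c'} σ = σ b̃ - b̃`
    have hval : ∀ σ : Hn, ((cc c).1 σ - ((σ : absoluteGaloisGroup K) • rt (yr c : P) (hM₁A (yr c)) -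
        rt (yr c : P) (hM₁A (yr c)))) - ((cc c').1 σ - ((σ : absoluteGaloisGroup K) •
          rt (yr c' : P) (hM₁A (yr c')) - rt (yr c' : P) (hM₁A (yr c')))) =
        (σ : absoluteGaloisGroup K) • rt b (hAₙA b) - rt b (hAₙA b) := by
      intro σ
      have h : ιZ (((kum b : HomZ) : Hn → Z) σ) = ιZ (((chi c - chi c' : HomZ) : Hn → Z) σ) := by rw [hb]
      rw [hkum_apply, AddSubgroup.coe_sub, Pi.sub_apply, map_sub, hchi_apply, hchi_apply] at h
      exact h.symm
    -- on `H_∞`: `a = ỹ' - ỹ - b̃` is fixed, hence `a ∈ M₁`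
    set a : P := rt (yr c' : P) (hM₁A (yr c')) - rt (yr c : P) (hM₁A (yr c)) - rt b (hAₙA b) with ha_def
    have haA : a ∈ A₁ := A₁.sub_mem (A₁.sub_mem (hrtA _ _) (hrtA _ _)) (hrtA _ _)
    have hafix : ∀ h ∈ localSubgroup κ.kerSubgroup K, h • a = a := by
      intro h hh
      have hhn : h ∈ Hn := localSubgroup_ker_le_layer κ K n hh
      have e := hval ⟨h, hhn⟩
      rw [hcc0 c ⟨h, hhn⟩ hh, hcc0 c' ⟨h, hhn⟩ hh, zero_sub, zero_sub] at e
      change -(h • rt (yr c : P) (hM₁A (yr c)) - rt (yr c : P) (hM₁A (yr c))) -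
        -(h • rt (yr c' : P) (hM₁A (yr c')) - rt (yr c' : P) (hM₁A (yr c'))) =
          h • rt b (hAₙA b) - rt b (hAₙA b) at e
      rw [ha_def, smul_sub, smul_sub]
      -- linear rearrangement of `e`
      have e' := sub_eq_zero.mpr e
      rw [← sub_eq_zero]
      rw [← e']
      abel
    have haM : a ∈ M₁ := (hM₁ a).mpr ⟨haA, hafix⟩
    -- at `g`: `x - x' = g (-a) - (-a)`
    have eγ := hval γ
    rw [hccγ c, hccγ c'] at eγ
    change (xr c : P) - (g • rt (yr c : P) (hM₁A (yr c)) - rt (yr c : P) (hM₁A (yr c))) -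
      ((xr c' : P) - (g • rt (yr c' : P) (hM₁A (yr c')) - rt (yr c' : P) (hM₁A (yr c')))) =
        g • rt b (hAₙA b) - rt b (hAₙA b) at eγ
    have hxx : (xr c : P) - xr c' = g • (-a) - (-a) := by
      have e' := sub_eq_zero.mpr eγ
      rw [← sub_eq_zero, ← e', ha_def]
      simp only [smul_sub, smul_neg]
      abel
    have hD : xr c - xr c' = D₁ ⟨-a, M₁.neg_mem haM⟩ := by
      refine Subtype.ext ?_
      rw [AddSubgroup.coe_sub, hD₁]
      exact hxx
    apply Subtype.ext
    rw [← hxr c, ← hxr c', QuotientAddGroup.eq_iff_sub_mem, hD]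
    exact ⟨_, rfl⟩
  -- counting
  haveI : Finite (HomZ ⧸ kum.range) := inferInstance
  have h1 : Nat.card {c : M₁ ⧸ D₁.range // p • c = 0} ≤ Nat.card (HomZ ⧸ kum.range) :=
    Nat.card_le_card_of_injective Φ hΦ
  have h2 : Nat.card HomZ = Nat.card (HomZ ⧸ kum.range) * Nat.card kum.range :=
    AddSubgroup.card_eq_card_quotient_mul_card_addSubgroup _
  refine ⟨Finite.of_injective Φ hΦ, ?_, ?_⟩
  · rw [← hker]
    exact Finite.of_equiv _ (QuotientAddGroup.quotientKerEquivRange kum).toEquiv.symm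
  · rw [hcardHomZ, h2, hcardK]
    exact Nat.mul_le_mul_right _ h1

end Summit.BirchSwinnertonDyer.BirchSwinnertonDyer.Theorems.GoodOrdTower

end
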